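import Summits.AtomisticToContinuum.HydrodynamicLimit.Theorems.InformationPercolationEnginePercolationClosesChaosForecastDefs
import Literature.MathematicalPhysics.KineticTheory.HardSphereEulerProofs
import HarnessLib

/-!
# Local equilibrium S5 of the line `equilibrium-forecast-chain-rule` (crux `InformationPercolationEngine.PercolationClosesChaos`,
stmt-AtomisticToContinuum-15178) — piece K: velocity-perturbation stability of the smoothed velocity law of a cell, in `L¹`

Support file (`--supports stmt-AtomisticToContinuum-15178`) of the registered stub
`stub_cesaroLocalEquilibrium : PredictableProjection → MesoConditionalEquidistribution → LocalCountUI →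
NoMesoscopicOscillation → CoarseLocalMaxwellianity` (worker S5 of lead c3). The predictable projection (S1) runs on
increments that are functions of the REVEALED data (cells and velocity BINS of width `b`), whereas the line's coarse functionals
(`kde`, `inhom`, `relEnt` of `…ForecastDefs` §3) read exact velocities; S5/S6 bridge the two with DETERMINISTIC stability estimates
of these functionals under velocity perturbations `≤ η` (`η = b√3/2` for bin centres). This file lands the first layer — the
Gaussian kernel density estimate and the inhomogeneity functional in `L¹`, with explicit constants UNIFORM in `N` and in the
population (the estimate is an average, so the single-kernel bound passes through by convexity):

* `abs_exp_neg_sub_exp_neg_le` — `|e^{-x} − e^{-y}| ≤ |x − y| (e^{-x} + e^{-y})` (from `1 − t ≤ e^{-t}`);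
* `abs_localMaxwellian_sub_le` — pointwise `|M_{θ,a}(v) − M_{θ,a'}(v)| ≤ ‖a−a'‖/(2θ) · (‖v−a‖ + ‖v−a'‖)(M_{θ,a}(v) + M_{θ,a'}(v))`;
* `integral_norm_sub_mul_localMaxwellian_le` — first absolute moment `∫ ‖v − b‖ M_{θ,a}(v) dv ≤ 2√θ + ‖a − b‖`
  (transfer to the standard Gaussian, `‖w‖ ≤ (1 + ‖w‖²)/2`, `E‖w‖² = 3`);
* `integral_abs_localMaxwellian_sub_le` — `∫ |M_{θ,a} − M_{θ,a'}| ≤ ‖a − a'‖ (4√θ + ‖a − a'‖)/θ`;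
* `integral_abs_kde_sub_kde_le` (registered helper, the headline) — for populations whose velocities move by at most `η`:
  `∫ |kde ϑ w P − kde ϑ w' P| ≤ η (4ϑ + η)/ϑ²`;
* `abs_inhom_sub_inhom_le` — hence `|inhom ϑ w P Q − inhom ϑ w' P Q| ≤ 2 η (4ϑ + η)/ϑ²`.

The entropy layer (`relEnt`, which also needs a speed cutoff for the logarithm) is NOT here.
-/

noncomputable section

open MeasureTheory Set Filter Topology ProbabilityTheory
open scoped ENNReal BigOperators Classical
open Literature.Analysis.FluidPDE Literature.MathematicalPhysics.KineticTheory
open Literature.MathematicalPhysics.KineticTheory.VelocityBlindPlacement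

namespace Summit.AtomisticToContinuum.HydrodynamicLimit.Theorems.EquilibriumForecastLine

/-! ## One Gaussian kernel -/

/-- `|e^{-x} − e^{-y}| ≤ |x − y| · (e^{-x} + e^{-y})` for all real `x, y`. [folklore] -/
theorem abs_exp_neg_sub_exp_neg_le (x y : ℝ) :
    |Real.exp (-x) - Real.exp (-y)| ≤ |x - y| * (Real.exp (-x) + Real.exp (-y)) := by
  -- the one-sided bound `e^{-x} - e^{-y} ≤ (y - x) e^{-x}` for `x ≤ y`, from `1 - t ≤ e^{-t}`
  have key : ∀ x y : ℝ, x ≤ y → Real.exp (-x) - Real.exp (-y) ≤ (y - x) * Real.exp (-x) := by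
    intro x y hxy
    have h1 : 1 - (y - x) ≤ Real.exp (-(y - x)) := Real.one_sub_le_exp_neg _
    have h2 : Real.exp (-y) = Real.exp (-x) * Real.exp (-(y - x)) := by
      rw [← Real.exp_add]; ring_nf
    rw [h2]
    nlinarith [Real.exp_pos (-x)]
  rcases le_total x y with hxy | hxy
  · have hmono : Real.exp (-y) ≤ Real.exp (-x) := Real.exp_le_exp.2 (by linarith)
    rw [abs_of_nonneg (by linarith), abs_of_nonpos (by linarith)]
    nlinarith [key x y hxy, Real.exp_pos (-x), Real.exp_pos (-y)]
  · have hmono : Real.exp (-x) ≤ Real.exp (-y) := Real.exp_le_exp.2 (by linarith)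
    rw [abs_of_nonpos (by linarith), abs_of_nonneg (by linarith)]
    nlinarith [key y x hxy, Real.exp_pos (-x), Real.exp_pos (-y)]

/-- **Pointwise translation bound for the Gaussian kernel**: for `θ > 0`,
`|M_{1,a,θ}(v) − M_{1,a',θ}(v)| ≤ ‖a − a'‖/(2θ) · ((‖v − a‖ + ‖v − a'‖) · (M_{1,a,θ}(v) + M_{1,a',θ}(v)))`. [folklore] -/
theorem abs_localMaxwellian_sub_le {θ : ℝ} (hθ : 0 < θ) (a a' v : V3) :
    |localMaxwellian 1 θ a v - localMaxwellian 1 θ a' v| ≤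
      ‖a - a'‖ / (2 * θ) * ((‖v - a‖ + ‖v - a'‖) * (localMaxwellian 1 θ a v + localMaxwellian 1 θ a' v)) := by
  set c : ℝ := (2 * Real.pi * θ) ^ (-(Module.finrank ℝ V3 : ℝ) / 2) with hc
  have hc0 : 0 ≤ c := Real.rpow_nonneg (by positivity) _
  set x : ℝ := ‖v - a‖ ^ 2 / (2 * θ) with hx
  set y : ℝ := ‖v - a'‖ ^ 2 / (2 * θ) with hy
  have hMa : localMaxwellian 1 θ a v = c * Real.exp (-x) := by
    simp only [localMaxwellian, one_mul, hc, hx, neg_div]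
  have hMa' : localMaxwellian 1 θ a' v = c * Real.exp (-y) := by
    simp only [localMaxwellian, one_mul, hc, hy, neg_div]
  have hxy : |x - y| ≤ ‖a - a'‖ / (2 * θ) * (‖v - a‖ + ‖v - a'‖) := by
    have h1 : x - y = (‖v - a‖ - ‖v - a'‖) * (‖v - a‖ + ‖v - a'‖) / (2 * θ) := by
      rw [hx, hy]; ring
    have h2 : |‖v - a‖ - ‖v - a'‖| ≤ ‖a - a'‖ := by
      have := abs_norm_sub_norm_le (v - a) (v - a')
      rwa [sub_sub_sub_cancel_left, norm_sub_rev a' a] at this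
    have h3 : 0 ≤ ‖v - a‖ + ‖v - a'‖ := by positivity
    rw [h1, abs_div, abs_mul, abs_of_nonneg h3, abs_of_pos (by positivity : (0 : ℝ) < 2 * θ)]
    rw [div_mul_eq_mul_div]
    exact div_le_div_of_nonneg_right (mul_le_mul_of_nonneg_right h2 h3) (by positivity)
  have hexp := abs_exp_neg_sub_exp_neg_le x y
  have hpos : 0 ≤ Real.exp (-x) + Real.exp (-y) := by positivity
  calc |localMaxwellian 1 θ a v - localMaxwellian 1 θ a' v| = c * |Real.exp (-x) - Real.exp (-y)| := by
        rw [hMa, hMa', ← mul_sub, abs_mul, abs_of_nonneg hc0]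
    _ ≤ c * (|x - y| * (Real.exp (-x) + Real.exp (-y))) := mul_le_mul_of_nonneg_left hexp hc0
    _ = |x - y| * (c * Real.exp (-x) + c * Real.exp (-y)) := by ring
    _ ≤ ‖a - a'‖ / (2 * θ) * (‖v - a‖ + ‖v - a'‖) * (c * Real.exp (-x) + c * Real.exp (-y)) :=
        mul_le_mul_of_nonneg_right hxy (by positivity)
    _ = _ := by rw [hMa, hMa']; ring

/-- `‖v − b‖ · M_{1,a,θ}(v)` is integrable (`θ > 0`): the Gaussian law has a first moment. [folklore] -/
theorem integrable_norm_sub_mul_localMaxwellian {θ : ℝ} (hθ : 0 < θ) (a b : V3) :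
    Integrable (fun v : V3 => ‖v - b‖ * localMaxwellian 1 θ a v) := by
  have hg : Integrable (fun v : V3 => ‖v - b‖) (gaussMeasure a θ) :=
    (IsGaussian.integrable_id.sub (integrable_const b)).norm
  rw [← withDensity_localMaxwellian_eq_gaussMeasure hθ a,
    integrable_withDensity_iff_integrable_smul' (continuous_localMaxwellian 1 θ a).measurable.ennreal_ofReal
      (Eventually.of_forall fun _ => ENNReal.ofReal_lt_top)] at hg
  refine (integrable_congr (Eventually.of_forall fun v => ?_)).1 hg
  simp only [ENNReal.toReal_ofReal (localMaxwellian_nonneg zero_le_one hθ.le a v), smul_eq_mul, mul_comm]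

/-- First absolute moment of the standard Gaussian on `ℝ³`: `E‖w‖ ≤ 2` (`‖w‖ ≤ (1 + ‖w‖²)/2`, `E‖w‖² = 3`). [folklore] -/
theorem integral_norm_stdGaussian_le_two : ∫ w, ‖w‖ ∂stdGaussian V3 ≤ 2 := by
  have h1 : ∫ w, ‖w‖ ∂stdGaussian V3 ≤ ∫ w, (1 + ‖w‖ ^ 2) / 2 ∂stdGaussian V3 := by
    refine integral_mono IsGaussian.integrable_id.norm
      (((integrable_const 1).add integrable_norm_sq_stdGaussian).div_const 2) fun w => ?_
    nlinarith [sq_nonneg (‖w‖ - 1)]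
  have h2 : ∫ w, (1 + ‖w‖ ^ 2) / 2 ∂stdGaussian V3 = 2 := by
    rw [integral_div, integral_add (integrable_const 1) integrable_norm_sq_stdGaussian, integral_const,
      integral_norm_sq_stdGaussian]
    simp
    norm_num
  linarith

/-- **First absolute moment of the Gaussian kernel**: `∫ ‖v − b‖ M_{1,a,θ}(v) dv ≤ 2√θ + ‖a − b‖` (`θ > 0`). [folklore] -/
theorem integral_norm_sub_mul_localMaxwellian_le {θ : ℝ} (hθ : 0 < θ) (a b : V3) :
    ∫ v, ‖v - b‖ * localMaxwellian 1 θ a v ≤ 2 * Real.sqrt θ + ‖a - b‖ := by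
  have hsq : 0 ≤ Real.sqrt θ := Real.sqrt_nonneg θ
  -- reduce to `b = a` through `‖v - b‖ ≤ ‖v - a‖ + ‖a - b‖`
  have hmain : ∫ v, ‖v - a‖ * localMaxwellian 1 θ a v ≤ 2 * Real.sqrt θ := by
    have h := integral_localMaxwellian_smul hθ a (fun v : V3 => ‖v - a‖)
    simp only [smul_eq_mul, add_sub_cancel_left, norm_smul, Real.norm_eq_abs, abs_of_nonneg hsq] at h
    rw [show (fun v : V3 => ‖v - a‖ * localMaxwellian 1 θ a v) = fun v => localMaxwellian 1 θ a v * ‖v - a‖ from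
      funext fun v => mul_comm _ _, h, integral_const_mul]
    nlinarith [integral_norm_stdGaussian_le_two, hsq]
  have hle : ∀ v : V3, ‖v - b‖ * localMaxwellian 1 θ a v ≤
      ‖v - a‖ * localMaxwellian 1 θ a v + ‖a - b‖ * localMaxwellian 1 θ a v := by
    intro v
    have hM := localMaxwellian_nonneg zero_le_one hθ.le a v
    have : ‖v - b‖ ≤ ‖v - a‖ + ‖a - b‖ := norm_sub_le_norm_sub_add_norm_sub v a b
    nlinarith
  calc ∫ v, ‖v - b‖ * localMaxwellian 1 θ a v
      ≤ ∫ v, ‖v - a‖ * localMaxwellian 1 θ a v + ‖a - b‖ * localMaxwellian 1 θ a v :=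
        integral_mono (integrable_norm_sub_mul_localMaxwellian hθ a b)
          ((integrable_norm_sub_mul_localMaxwellian hθ a a).add ((integrable_localMaxwellian hθ a).const_mul _)) hle
    _ = (∫ v, ‖v - a‖ * localMaxwellian 1 θ a v) + ‖a - b‖ := by
        rw [integral_add (integrable_norm_sub_mul_localMaxwellian hθ a a) ((integrable_localMaxwellian hθ a).const_mul _),
          integral_const_mul, integral_localMaxwellian_one hθ a, mul_one]
    _ ≤ 2 * Real.sqrt θ + ‖a - b‖ := by linarith

/-- **Translation bound for the Gaussian kernel in `L¹`**: `∫ |M_{1,a,θ} − M_{1,a',θ}| ≤ ‖a − a'‖ (4√θ + ‖a − a'‖)/θ`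
(`θ > 0`). [folklore] -/
theorem integral_abs_localMaxwellian_sub_le {θ : ℝ} (hθ : 0 < θ) (a a' : V3) :
    ∫ v, |localMaxwellian 1 θ a v - localMaxwellian 1 θ a' v| ≤ ‖a - a'‖ * (4 * Real.sqrt θ + ‖a - a'‖) / θ := by
  set d : ℝ := ‖a - a'‖ with hd
  have hd0 : 0 ≤ d := norm_nonneg _
  have hI := integrable_norm_sub_mul_localMaxwellian hθ
  -- the four first moments
  have h1 := integral_norm_sub_mul_localMaxwellian_le hθ a a
  have h2 := integral_norm_sub_mul_localMaxwellian_le hθ a a'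
  have h3 := integral_norm_sub_mul_localMaxwellian_le hθ a' a
  have h4 := integral_norm_sub_mul_localMaxwellian_le hθ a' a'
  rw [sub_self, norm_zero, add_zero] at h1 h4
  rw [norm_sub_rev] at h3
  have hint : Integrable (fun v : V3 => d / (2 * θ) * (‖v - a‖ * localMaxwellian 1 θ a v +
      ‖v - a'‖ * localMaxwellian 1 θ a v + ‖v - a‖ * localMaxwellian 1 θ a' v +
      ‖v - a'‖ * localMaxwellian 1 θ a' v)) :=
    ((((hI a a).add (hI a a')).add (hI a' a)).add (hI a' a')).const_mul _
  calc ∫ v, |localMaxwellian 1 θ a v - localMaxwellian 1 θ a' v|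
      ≤ ∫ v, d / (2 * θ) * (‖v - a‖ * localMaxwellian 1 θ a v + ‖v - a'‖ * localMaxwellian 1 θ a v +
          ‖v - a‖ * localMaxwellian 1 θ a' v + ‖v - a'‖ * localMaxwellian 1 θ a' v) := by
        refine integral_mono_of_nonneg (Eventually.of_forall fun v => abs_nonneg _) hint
          (Eventually.of_forall fun v => ?_)
        have h := abs_localMaxwellian_sub_le hθ a a' v
        calc |localMaxwellian 1 θ a v - localMaxwellian 1 θ a' v| ≤ _ := h
          _ = _ := by rw [hd]; ring
    _ = d / (2 * θ) * ((∫ v, ‖v - a‖ * localMaxwellian 1 θ a v) + (∫ v, ‖v - a'‖ * localMaxwellian 1 θ a v) +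
          (∫ v, ‖v - a‖ * localMaxwellian 1 θ a' v) + ∫ v, ‖v - a'‖ * localMaxwellian 1 θ a' v) := by
        have hAB : Integrable (fun v : V3 => ‖v - a‖ * localMaxwellian 1 θ a v +
            ‖v - a'‖ * localMaxwellian 1 θ a v) := (hI a a).add (hI a a')
        have hABC : Integrable (fun v : V3 => ‖v - a‖ * localMaxwellian 1 θ a v +
            ‖v - a'‖ * localMaxwellian 1 θ a v + ‖v - a‖ * localMaxwellian 1 θ a' v) := hAB.add (hI a' a)
        rw [integral_const_mul, integral_add hABC (hI a' a'), integral_add hAB (hI a' a), integral_add (hI a a) (hI a a')]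
    _ ≤ d / (2 * θ) * (8 * Real.sqrt θ + 2 * d) := by
        refine mul_le_mul_of_nonneg_left ?_ (by positivity)
        linarith
    _ = d * (4 * Real.sqrt θ + d) / θ := by
        field_simp
        ring

/-! ## The kernel density estimate and the inhomogeneity of a cell -/

/-- `kde` is integrable for `ϑ ≠ 0`. [folklore] -/
theorem integrable_kde' {N : ℕ} {ϑ : ℝ} (hϑ : ϑ ≠ 0) (w : Phase N) (P : Finset (Fin (N + 1))) :
    Integrable (kde ϑ w P) := by
  have hθ : 0 < ϑ ^ 2 := by positivity
  unfold kde
  exact (integrable_finsetSum P fun i _ => integrable_localMaxwellian hθ ((w i).2)).const_mul _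

/-- **Registered helper `integral_abs_kde_sub_kde_le` (piece K of S5): velocity-perturbation stability of the smoothed velocity
law in `L¹`.** If the velocities of the population `P` move by at most `η` (positions, hence `P`, unchanged), then
`∫ |kde ϑ w P − kde ϑ w' P| ≤ η (4ϑ + η)/ϑ²` — uniformly in `N` and `P`. [folklore] -/
theorem integral_abs_kde_sub_kde_le : ∀ {N : ℕ} {ϑ : ℝ}, 0 < ϑ → ∀ (w w' : Phase N) (P : Finset (Fin (N + 1))) {η : ℝ}, 0 ≤ η → (∀ i ∈ P, ‖(w i).2 - (w' i).2‖ ≤ η) → ∫ v, |kde ϑ w P v - kde ϑ w' P v| ≤ η * (4 * ϑ + η) / ϑ ^ 2 := by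
  intro N ϑ hϑ w w' P η hη0 hη
  have hθ : 0 < ϑ ^ 2 := by positivity
  have hsqrt : Real.sqrt (ϑ ^ 2) = ϑ := Real.sqrt_sq hϑ.le
  have hRHS : 0 ≤ η * (4 * ϑ + η) / ϑ ^ 2 := by positivity
  rcases P.eq_empty_or_nonempty with rfl | hP
  · simp only [kde, Finset.card_empty, Nat.cast_zero, inv_zero, Finset.sum_empty, mul_zero, sub_self, abs_zero,
      integral_zero]
    exact hRHS
  have hcard : (0 : ℝ) < P.card := by exact_mod_cast hP.card_pos
  -- single-kernel bounds, monotone in the displacement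
  have hone : ∀ i ∈ P, ∫ v, |localMaxwellian 1 (ϑ ^ 2) (w i).2 v - localMaxwellian 1 (ϑ ^ 2) (w' i).2 v| ≤
      η * (4 * ϑ + η) / ϑ ^ 2 := by
    intro i hi
    have h := integral_abs_localMaxwellian_sub_le hθ (w i).2 (w' i).2
    rw [hsqrt] at h
    refine h.trans ?_
    have hdi := hη i hi
    have hd0 : 0 ≤ ‖(w i).2 - (w' i).2‖ := norm_nonneg _
    rw [div_le_div_iff_of_pos_right hθ]
    nlinarith
  have hIi : ∀ i ∈ P, Integrable fun v : V3 =>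
      |localMaxwellian 1 (ϑ ^ 2) (w i).2 v - localMaxwellian 1 (ϑ ^ 2) (w' i).2 v| :=
    fun i _ => ((integrable_localMaxwellian hθ _).sub (integrable_localMaxwellian hθ _)).abs
  -- convexity: the estimate is an average of kernels
  have hpt : ∀ v : V3, |kde ϑ w P v - kde ϑ w' P v| ≤
      ((P.card : ℝ))⁻¹ * ∑ i ∈ P, |localMaxwellian 1 (ϑ ^ 2) (w i).2 v - localMaxwellian 1 (ϑ ^ 2) (w' i).2 v| := by
    intro v
    simp only [kde]
    rw [← mul_sub, ← Finset.sum_sub_distrib, abs_mul, abs_of_nonneg (inv_nonneg.2 hcard.le)]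
    exact mul_le_mul_of_nonneg_left (Finset.abs_sum_le_sum_abs _ _) (inv_nonneg.2 hcard.le)
  calc ∫ v, |kde ϑ w P v - kde ϑ w' P v|
      ≤ ∫ v, ((P.card : ℝ))⁻¹ * ∑ i ∈ P,
          |localMaxwellian 1 (ϑ ^ 2) (w i).2 v - localMaxwellian 1 (ϑ ^ 2) (w' i).2 v| :=
        integral_mono_of_nonneg (Eventually.of_forall fun v => abs_nonneg _)
          ((integrable_finsetSum P hIi).const_mul _) (Eventually.of_forall hpt)
    _ = ((P.card : ℝ))⁻¹ * ∑ i ∈ P,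
          ∫ v, |localMaxwellian 1 (ϑ ^ 2) (w i).2 v - localMaxwellian 1 (ϑ ^ 2) (w' i).2 v| := by
        rw [integral_const_mul, integral_finsetSum P hIi]
    _ ≤ ((P.card : ℝ))⁻¹ * ∑ _i ∈ P, η * (4 * ϑ + η) / ϑ ^ 2 :=
        mul_le_mul_of_nonneg_left (Finset.sum_le_sum hone) (inv_nonneg.2 hcard.le)
    _ = η * (4 * ϑ + η) / ϑ ^ 2 := by
        rw [Finset.sum_const, nsmul_eq_mul, ← mul_assoc, inv_mul_cancel₀ hcard.ne', one_mul]

/-- **Stability of the inhomogeneity functional**: if the velocities of `P` and of `Q` move by at most `η`, then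
`|inhom ϑ w P Q − inhom ϑ w' P Q| ≤ 2 · η (4ϑ + η)/ϑ²`. [folklore] -/
theorem abs_inhom_sub_inhom_le {N : ℕ} {ϑ : ℝ} (hϑ : 0 < ϑ) (w w' : Phase N) (P Q : Finset (Fin (N + 1))) {η : ℝ}
    (hη0 : 0 ≤ η) (hηP : ∀ i ∈ P, ‖(w i).2 - (w' i).2‖ ≤ η) (hηQ : ∀ i ∈ Q, ‖(w i).2 - (w' i).2‖ ≤ η) :
    |inhom ϑ w P Q - inhom ϑ w' P Q| ≤ 2 * (η * (4 * ϑ + η) / ϑ ^ 2) := by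
  have hP := integral_abs_kde_sub_kde_le hϑ w w' P hη0 hηP
  have hQ := integral_abs_kde_sub_kde_le hϑ w w' Q hη0 hηQ
  have hIP := integrable_kde' hϑ.ne' w P
  have hIQ := integrable_kde' hϑ.ne' w Q
  have hIP' := integrable_kde' hϑ.ne' w' P
  have hIQ' := integrable_kde' hϑ.ne' w' Q
  have hA : Integrable (fun v : V3 => |kde ϑ w P v - kde ϑ w Q v|) := (hIP.sub hIQ).abs
  have hB : Integrable (fun v : V3 => |kde ϑ w' P v - kde ϑ w' Q v|) := (hIP'.sub hIQ').abs
  unfold inhom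
  rw [← integral_sub hA hB]
  refine (abs_integral_le_integral_abs).trans ?_
  have hpt : ∀ v : V3, |(|kde ϑ w P v - kde ϑ w Q v| - |kde ϑ w' P v - kde ϑ w' Q v|)| ≤
      |kde ϑ w P v - kde ϑ w' P v| + |kde ϑ w Q v - kde ϑ w' Q v| := by
    intro v
    refine (abs_abs_sub_abs_le_abs_sub _ _).trans ?_
    have : kde ϑ w P v - kde ϑ w Q v - (kde ϑ w' P v - kde ϑ w' Q v) =
        (kde ϑ w P v - kde ϑ w' P v) - (kde ϑ w Q v - kde ϑ w' Q v) := by ring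
    rw [this]
    exact abs_sub _ _
  calc ∫ v, |(|kde ϑ w P v - kde ϑ w Q v| - |kde ϑ w' P v - kde ϑ w' Q v|)|
      ≤ ∫ v, |kde ϑ w P v - kde ϑ w' P v| + |kde ϑ w Q v - kde ϑ w' Q v| :=
        integral_mono_of_nonneg (Eventually.of_forall fun v => abs_nonneg _)
          ((hIP.sub hIP').abs.add (hIQ.sub hIQ').abs) (Eventually.of_forall hpt)
    _ = (∫ v, |kde ϑ w P v - kde ϑ w' P v|) + ∫ v, |kde ϑ w Q v - kde ϑ w' Q v| :=
        integral_add (hIP.sub hIP').abs (hIQ.sub hIQ').abs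
    _ ≤ 2 * (η * (4 * ϑ + η) / ϑ ^ 2) := by linarith

end Summit.AtomisticToContinuum.HydrodynamicLimit.Theorems.EquilibriumForecastLine

end
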